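import Summits.BirchSwinnertonDyer.BirchSwinnertonDyer.Theorems.QuadraticBranchSignedControlGss2Assembly
import Summits.BirchSwinnertonDyer.BirchSwinnertonDyer.Theorems.QuadraticBranchSignedControlEtaTransportPlus
import HarnessLib

/-!
# Route `QuadraticBranchSignedControl` (rung K8, cell `bsd-potss`), crux `EtaTransportSigned`
# (stmt-BirchSwinnertonDyer-19115): the support `Gss2Assembly` BY ANALYTIC RANK — where the crux's
# cite-level residue (Kobayashi 2003 Thm. 7.4 at `η`, item 19584 `PublishedInputThm74`) is consumed

WHAT. The crux `EtaTransportSigned = (MC⁺_η) ∧ (MC⁻_η)` is SPLIT on the route (rev 11): its open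
mathematics `EtaLayerComparison` (19583) is PROVED (`etaLayerComparison_proof`, seat k8q-c3 g2), so the
PLUS conjunct is an unconditional theorem (`etaTransportPlus`, p442838), and the whole crux follows from
the held published input `PublishedInputThm74` = `Kobayashi2003.thm74_etaEvenMC_iff_etaOddMC` alone
(`etaTransportSigned_of_thm74`; the MINUS conjunct IS Kobayashi's Thm. 7.4 (ii) ⟹ (iii) at `η`, whose
proof — Coleman maps (Thm. 6.2), the explicit reciprocity law `Col(z_Kato) = L_p^±` (Thm. 6.3), the
Poitou–Tate sequence (7.21), `X⁰ ≅ 𝐇²(T)` torsion (Prop. 7.1 ii, Cor. 7.2, Kato Thm. 12.4) — has no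
vocabulary in the tree: seat k8q-c3 g3 reduced it by name to `Kobayashi2003.thm74proof_etaExactSequences`).
THIS FILE reads that state back INTO THE ASSEMBLY, rank by rank, following the pair theorem
`missingPPartAt_of_signedControlCruxes_of_periodRatio` (seat ctrl g3, p413892) which consumes
`EtaTransportSigned.1` on analytic rank `0` and `EtaTransportSigned.2` on analytic rank `1`:
* §1 **analytic rank `0`** (the 216 `r_an = 0` Gss2 classes of board row B4, `p ≥ 5`):
  `MissingPPartAt W p` from (C1_η) `PlusMainConjectureBranch` + (R2⁺) `NoFiniteSubmodulePlus` + the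
  published inputs (GZK, modularity ×2, Poitou–Tate) + the `p`-integral period ratio (displayed binder
  `hper`, or Mazur's `p ∤ c₀`) — `EtaTransportSigned` is DISCHARGED by `etaTransportPlus`; neither
  Kobayashi's Thm. 7.4, nor (R2⁻), nor the `p`-adic Gross–Zagier residual `PAdicGrossZagierBranch`
  (19116), nor Gross–Zagier I.(7.3) enters the rank-`0` trust base;
* §2 **analytic rank `1`** (the 157 `r_an = 1` classes): `MissingPPartAt W p` from (C1_η) + the held
  input `PublishedInputThm74` BY NAME + (R2⁻) `NoFiniteSubmoduleMinus` + the residual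
  `PAdicGrossZagierBranch` + the published inputs — i.e. on the rows where the crux's cite-level residue
  IS used, those rows are already conditional on the declared residual 19116;
* §3 the support `Gss2Assembly` and the pair theorem with `EtaTransportSigned` REPLACED by
  `PublishedInputThm74` (all ranks `≤ 1`), and the class-facing `∀ W p` corollaries of §1.

HONEST FRAMING (cell `bsd-potss`, run/shared/lean/pub/bsd-potss/; FULL-BSD rank ≤ 1 programme):
BOOKKEEPING / TOOL THEOREMS ONLY. Every statement is CONDITIONAL on its displayed hypotheses: (C1_η)
`PlusMainConjectureBranch` is an OPEN conjecture (route crux family 19114), (R2±) are route items settled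
by citation (Kitajima–Otsuki 2018, `PublishedInputKO13`), `PublishedInputThm74` and the published inputs
are named Literature facts with no `_holds`, `PAdicGrossZagierBranch` is a declared residual. The crux
19115 is NOT closed by this file (it stays open exactly at its held input 19584); `BSD(W, p)` is claimed
for no pair; nothing is booked; no label / mark / count moves; BSD is not proved by any of this. No
definition, no named fact introduced, no `sorry`, axioms standard. Seat `bsd-potss-k8q-c3` (prover), g4;
`--supports stmt-BirchSwinnertonDyer-19115`.

References: [Kobayashi2003] Thm. 3.2 (p. 7), §4 (p. 8), Thm. 7.4 (p. 13), Thm. 9.3 (p. 26);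
[KitajimaOtsuki2018] Main Thm. 1.3 (arXiv:1607.03612 p. 3); [Mazur1978] Cor. 4.1;
[MilneADT2006] I Thm. 4.10; [GrossZagier1986] Thm. I.(7.3); [Miller2011LMS] §1, Def. 1.1.
-/

set_option autoImplicit false
set_option linter.dupNamespace false

noncomputable section

open scoped Classical MatrixGroups ModularForm

open CongruenceSubgroup WeierstrassCurve
open Literature.NumberTheory.EllipticCurves
open Literature.NumberTheory.EllipticCurves.ModularForms
open Literature.NumberTheory.EllipticCurves.Kobayashi2003
open Literature.NumberTheory.EllipticCurves.Rank1Residual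
open Literature.NumberTheory.EllipticCurves.Rank1Residual.Typed
open Literature.NumberTheory.GaloisRepresentations
open Literature.NumberTheory.GaloisCohomology
open Summit.BirchSwinnertonDyer.Rank1Residual.Additive
open Summit.BirchSwinnertonDyer.BirchSwinnertonDyer.Theses.QuadraticBranchSignedControl

namespace Summit.BirchSwinnertonDyer.BirchSwinnertonDyer.Theorems

/-! ## §1 Analytic rank `0`: the crux `EtaTransportSigned` is DISCHARGED (plus half proved) -/

/-- **`ord_p #Ш(W) = ord_p #Ш_an(W)` on every Gss2 pair of analytic rank `0`, `p ≥ 5`, from (C1_η), (R2⁺),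
four published inputs (GZK, modularity as analytic continuation, the newform of the twin, Poitou–Tate)
and ONE displayed `p`-integral period-ratio binder `hper` — with NO `EtaTransportSigned`, NO Thm. 7.4,
NO (R2⁻), NO `p`-adic Gross–Zagier input.** The rank-`0` branch of
`missingPPartAt_of_signedControlCruxes_of_periodRatio` verbatim, its reading (R1⁺) now fed by the
PROVED plus half `etaTransportPlus` instead of the crux: the good supersingular twin `V` of `W` is
produced, (C1_η) at `V`, the newform, `ϖ`, `L_p⁺(V, η, X)`, `L(W,1) ≠ 0`, then the cell's EXACT even
control from (MC⁺_η) + (R2⁺) + Poitou–Tate and the value identity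
(`EvenControlZero.missingPPartAt_rankZero_of_readings`). CONDITIONAL on the displayed hypotheses;
nothing booked. [cite: Kobayashi2003, Thm. 3.2 (p. 7), §4 (p. 8), Thm. 9.3 (p. 26)]
[cite: KitajimaOtsuki2018, Main Thm. 1.3 (arXiv:1607.03612 p. 3)] [cite: MilneADT2006, I Thm. 4.10]
[cite: Miller2011LMS, §1 and Def. 1.1] -/
theorem missingPPartAt_gss2_rankZero_of_plusMC_of_noFiniteSubmodulePlus_of_periodRatio
    (hGZK : rank_eq_analyticRank_of_analyticRank_le_one) (hmod : hasEntireLFunction_rat)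
    (hnf : exists_isNewformOf) (hPT : poitouTate_selmerStructure_duality_real ℚ)
    (h₁ : PlusMainConjectureBranch) (h₃ : NoFiniteSubmodulePlus)
    (W : WeierstrassCurve ℚ) [W.IsElliptic] [W.IsGloballyMinimal] (p : ℕ) [Fact p.Prime]
    (hper : ∀ (V : WeierstrassCurve ℚ) [V.IsElliptic] [V.IsGloballyMinimal]
      {N : ℕ} [NeZero N] (f : CuspForm (Gamma0 N) 2), IsNewformOf V f →
      V.HasGoodReductionAtPrime p → V.frobeniusTrace p = 0 →
      ∃ ϖ : ℚ, ‖(ϖ : ℚ_[p])‖ ≤ 1 ∧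
        (if Even (p / 2) then (ϖ : ℝ) * V.realPeriodRat = plusPeriod f
          else (ϖ : ℝ) * V.imaginaryPeriodRat = minusPeriod f))
    (h0 : W.analyticRank = 0) (hp5 : 5 ≤ p) (hadd : Addv W p) (hGss : SubGss W p) :
    MissingPPartAt W p := by
  have hp2 : p ≠ 2 := by omega
  -- the good supersingular `p*`-twin `V` (Néron model of `W^{(p*)}`); `a_p(V) = 0` by Hasse at `p ≥ 5`
  obtain ⟨V, hVe, hVm, C, hCV, hss⟩ :=
    Summit.BirchSwinnertonDyer.Rank1Residual.O5.exists_goodSS_twist_pStar_of_subGss W p hp2 hadd hGss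
  have hgood : V.HasGoodReductionAtPrime p := hss.1
  have hap : V.frobeniusTrace p = 0 := (V.natCast_dvd_frobeniusTrace_iff_eq_zero p hp5 hgood).mp hss.2
  -- (C1_η) at the twin
  have h1 : QuadraticBranchPlusMainConjectureAt V p := h₁ V p hp5 hgood hap
  -- EXACT even control from (MC⁺_η) [= the PROVED plus half of the crux] + (R2⁺) + Poitou–Tate
  haveI : NeZero (V.conductorNorm ℤ) := ⟨V.conductorNorm_pos_holds.ne'⟩
  obtain ⟨f, hf⟩ := hnf V
  obtain ⟨ϖ, hϖ, hrel⟩ := hper V f hf hgood hap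
  obtain ⟨L, hL⟩ := exists_isQuadraticBranchPlusLFunction_of_isNewformOf hp2 hf hgood hap ϖ hϖ
  have hLW : W.entireLFunction 1 ≠ 0 := by
    rw [← W.leadingLCoeff_eq_of_analyticRank_eq_zero h0]
    exact W.leadingLCoeff_ne_zero_holds (hmod W)
  exact EvenControlZero.missingPPartAt_rankZero_of_readings W p hPT hGZK hmod
    (SignedTwist.evenBranchPlusCharIdealOfPlusMCAt_of_plusMCEta W p (etaTransportPlus p hp5))
    (h₃ W p hp5) V C hp5 hCV hgood hap h1 hf hrel hL hLW

/-- **The same rank-`0` pair theorem with the period ratio supplied by Mazur's `p ∤ c₀`** (Invent. Math.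
44 (1978) Cor. 4.1, named fact `ModularForms.mazur_not_dvd_maninConstant_of_odd`, via x1b's
`periodRatio_of_mazur`): (C1_η) + (R2⁺) + five published inputs ⟹ `MissingPPartAt W p` on every Gss2
pair of analytic rank `0`, `p ≥ 5` — NO `EtaTransportSigned`, NO Thm. 7.4, NO (R2⁻), NO `p`-adic
Gross–Zagier. CONDITIONAL; nothing booked. [cite: Mazur1978, Cor. 4.1]
[cite: Kobayashi2003, Thm. 3.2 (p. 7), §4 (p. 8)] [cite: Miller2011LMS, §1 and Def. 1.1] -/
theorem missingPPartAt_gss2_rankZero_of_plusMC_of_noFiniteSubmodulePlus_of_mazur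
    (hGZK : rank_eq_analyticRank_of_analyticRank_le_one) (hmod : hasEntireLFunction_rat)
    (hnf : exists_isNewformOf) (hPT : poitouTate_selmerStructure_duality_real ℚ)
    (hM : mazur_not_dvd_maninConstant_of_odd)
    (h₁ : PlusMainConjectureBranch) (h₃ : NoFiniteSubmodulePlus)
    (W : WeierstrassCurve ℚ) [W.IsElliptic] [W.IsGloballyMinimal] (p : ℕ) [Fact p.Prime]
    (h0 : W.analyticRank = 0) (hp5 : 5 ≤ p) (hadd : Addv W p) (hGss : SubGss W p) :
    MissingPPartAt W p :=
  missingPPartAt_gss2_rankZero_of_plusMC_of_noFiniteSubmodulePlus_of_periodRatio hGZK hmod hnf hPT h₁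
    h₃ W p (periodRatio_of_mazur p hM hp5) h0 hp5 hadd hGss

/-- **Class-facing form of §1: on the analytic-rank-`0` rows of Gss2 (`p ≥ 5`) the crux
`EtaTransportSigned` drops out of the assembly.** `PublishedInputsGss2 → PlusMainConjectureBranch →
NoFiniteSubmodulePlus → ∀ W p, r_an(W) = 0 → 5 ≤ p → Addv W p → SubGss W p → MissingPPartAt W p` (the
item `Gss2Assembly` restricted to `r_an = 0`, without its hypotheses `EtaTransportSigned`,
`PAdicGrossZagierBranch` and without the minus sign of `NoFiniteSubmoduleSigned`; Gross–Zagier I.(7.3)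
of the inputs is not used either). CONDITIONAL on the displayed hypotheses; nothing booked.
[cite: Kobayashi2003, §4 (p. 8), Thm. 9.3 (p. 26)] [cite: KitajimaOtsuki2018, Main Thm. 1.3]
[cite: Mazur1978, Cor. 4.1] -/
theorem gss2_rankZero_of_publishedInputs_of_plusMC_of_noFiniteSubmodulePlus
    (hP : PublishedInputsGss2) (h₁ : PlusMainConjectureBranch) (h₃ : NoFiniteSubmodulePlus) :
    ∀ (W : WeierstrassCurve ℚ) [W.IsElliptic] [W.IsGloballyMinimal] (p : ℕ) [Fact p.Prime],
      W.analyticRank = 0 → 5 ≤ p → Addv W p → SubGss W p → MissingPPartAt W p := by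
  intro W _ _ p _ h0 hp5 hadd hGss
  obtain ⟨hGZK, hmod, hnf, -, hPT, hM⟩ := hP
  exact missingPPartAt_gss2_rankZero_of_plusMC_of_noFiniteSubmodulePlus_of_mazur hGZK hmod hnf hPT hM
    h₁ h₃ W p h0 hp5 hadd hGss

/-! ## §2 Analytic rank `1`: the crux enters only through its held input `PublishedInputThm74` -/

/-- **`ord_p #Ш(W) = ord_p #Ш_an(W)` on every Gss2 pair of analytic rank `1`, `p ≥ 5`, from (C1_η), the
held published input `PublishedInputThm74` (Kobayashi 2003 Thm. 7.4 at `η`, BY NAME), (R2⁻), the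
declared residual `PAdicGrossZagierBranch`, five published inputs and the displayed period-ratio binder
`hper`.** The rank-`1` branch of `missingPPartAt_of_signedControlCruxes_of_periodRatio` verbatim, with
the exact odd-`η` reading fed by `(etaTransportSigned_of_thm74 h74).2` — x1b's chain
`LevelBridge.bsdp_of_plusMC_of_pAdicGrossZagierValuation_of_readings_of_periodRatio`, then
`missingPPartAt_of_bsdp` (Ш finite by GZK). CONDITIONAL on every displayed hypothesis (Thm. 7.4 is a
deep printed theorem with no `_holds`; `PAdicGrossZagierBranch` is a declared residual); nothing booked.
[cite: Kobayashi2003, Thm. 7.4 (p. 13), §4 (p. 8), Thm. 9.3 (p. 26)]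
[cite: GrossZagier1986, Thm. I.(7.3) (p. 230)] [cite: KitajimaOtsuki2018, Main Thm. 1.3]
[cite: Miller2011LMS, §1 and Def. 1.1] -/
theorem missingPPartAt_gss2_rankOne_of_plusMC_of_thm74_of_periodRatio
    (hGZK : rank_eq_analyticRank_of_analyticRank_le_one) (hmod : hasEntireLFunction_rat)
    (hnf : exists_isNewformOf) (hGZ : GrossZagier1986_thm_I_7_3)
    (hPT : poitouTate_selmerStructure_duality_real ℚ)
    (h₁ : PlusMainConjectureBranch) (h74 : PublishedInputThm74) (h₃ : NoFiniteSubmoduleMinus)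
    (h₄ : PAdicGrossZagierBranch)
    (W : WeierstrassCurve ℚ) [W.IsElliptic] [W.IsGloballyMinimal] (p : ℕ) [Fact p.Prime]
    (hper : ∀ (V : WeierstrassCurve ℚ) [V.IsElliptic] [V.IsGloballyMinimal]
      {N : ℕ} [NeZero N] (f : CuspForm (Gamma0 N) 2), IsNewformOf V f →
      V.HasGoodReductionAtPrime p → V.frobeniusTrace p = 0 →
      ∃ ϖ : ℚ, ‖(ϖ : ℚ_[p])‖ ≤ 1 ∧
        (if Even (p / 2) then (ϖ : ℝ) * V.realPeriodRat = plusPeriod f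
          else (ϖ : ℝ) * V.imaginaryPeriodRat = minusPeriod f))
    (h1r : W.analyticRank = 1) (hp5 : 5 ≤ p) (hadd : Addv W p) (hGss : SubGss W p) :
    MissingPPartAt W p := by
  have hp2 : p ≠ 2 := by omega
  have hr : W.analyticRank ≤ 1 := h1r.le
  -- the good supersingular `p*`-twin `V`; `a_p(V) = 0` by Hasse at `p ≥ 5`
  obtain ⟨V, hVe, hVm, C, hCV, hss⟩ :=
    Summit.BirchSwinnertonDyer.Rank1Residual.O5.exists_goodSS_twist_pStar_of_subGss W p hp2 hadd hGss
  have hgood : V.HasGoodReductionAtPrime p := hss.1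
  have hap : V.frobeniusTrace p = 0 := (V.natCast_dvd_frobeniusTrace_iff_eq_zero p hp5 hgood).mp hss.2
  -- (C1_η) at the twin; (MC±_η) from Kobayashi's Thm. 7.4 at `η` (held input) through the proved split
  have h1 : QuadraticBranchPlusMainConjectureAt V p := h₁ V p hp5 hgood hap
  have h₂ : EtaTransportSigned := etaTransportSigned_of_thm74 h74
  -- x1b's odd-branch chain with the exact odd control from (MC⁻_η) + (R2⁻) + Poitou–Tate and C-cc-1
  haveI : Finite W.sha := (hGZK W hr).2
  exact missingPPartAt_of_bsdp W p
    (LevelBridge.bsdp_of_plusMC_of_pAdicGrossZagierValuation_of_readings_of_periodRatio W p hmod hGZ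
      hGZK hPT hnf hper (h₃ W p hp5)
      (LevelBridge.exactOddBranchReading_of_kobayashi74OddEtaExact W p (h₂.2 p hp5))
      ((quadraticBranchPAdicGrossZagierValuationAt_iff W p).mpr (h₄ W p)) hp5 hCV hgood hap h1 h1r)

/-- **The same rank-`1` pair theorem with the period ratio supplied by Mazur's `p ∤ c₀`.** CONDITIONAL;
nothing booked. [cite: Mazur1978, Cor. 4.1] [cite: Kobayashi2003, Thm. 7.4 (p. 13), §4 (p. 8)]
[cite: GrossZagier1986, Thm. I.(7.3) (p. 230)] -/
theorem missingPPartAt_gss2_rankOne_of_plusMC_of_thm74_of_mazur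
    (hGZK : rank_eq_analyticRank_of_analyticRank_le_one) (hmod : hasEntireLFunction_rat)
    (hnf : exists_isNewformOf) (hGZ : GrossZagier1986_thm_I_7_3)
    (hPT : poitouTate_selmerStructure_duality_real ℚ) (hM : mazur_not_dvd_maninConstant_of_odd)
    (h₁ : PlusMainConjectureBranch) (h74 : PublishedInputThm74) (h₃ : NoFiniteSubmoduleMinus)
    (h₄ : PAdicGrossZagierBranch)
    (W : WeierstrassCurve ℚ) [W.IsElliptic] [W.IsGloballyMinimal] (p : ℕ) [Fact p.Prime]
    (h1r : W.analyticRank = 1) (hp5 : 5 ≤ p) (hadd : Addv W p) (hGss : SubGss W p) :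
    MissingPPartAt W p :=
  missingPPartAt_gss2_rankOne_of_plusMC_of_thm74_of_periodRatio hGZK hmod hnf hGZ hPT h₁ h74 h₃ h₄ W p
    (periodRatio_of_mazur p hM hp5) h1r hp5 hadd hGss

/-! ## §3 All ranks `≤ 1`: `Gss2Assembly` with the crux replaced by its held input -/

/-- **The support `Gss2Assembly` with `EtaTransportSigned` REPLACED by the held published input
`PublishedInputThm74`**: `PublishedInputsGss2 → PlusMainConjectureBranch → PublishedInputThm74 →
NoFiniteSubmoduleSigned → PAdicGrossZagierBranch → ∀ W p, r_an(W) ≤ 1 → 5 ≤ p → Addv W p → SubGss W p →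
MissingPPartAt W p` — `gss2Assembly_proof` fed with `etaTransportSigned_of_thm74`. This is the sense
in which crux 19115 is settled by citation inside the route: every consumer of the crux runs from
Kobayashi's Thm. 7.4 at `η` by name (and, by §1, the rank-`0` consumers do not even need that).
CONDITIONAL; nothing booked. [cite: Kobayashi2003, Thm. 7.4 (p. 13), §4 (p. 8)]
[cite: Mazur1978, Cor. 4.1] [cite: KitajimaOtsuki2018, Main Thm. 1.3] -/
theorem gss2Assembly_of_thm74 (hP : PublishedInputsGss2) (h₁ : PlusMainConjectureBranch)
    (h74 : PublishedInputThm74) (h₃ : NoFiniteSubmoduleSigned) (h₄ : PAdicGrossZagierBranch) :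
    ∀ (W : WeierstrassCurve ℚ) [W.IsElliptic] [W.IsGloballyMinimal] (p : ℕ) [Fact p.Prime],
      W.analyticRank ≤ 1 → 5 ≤ p → Addv W p → SubGss W p → MissingPPartAt W p :=
  fun W _ _ p _ hr hp5 hadd hGss =>
    gss2Assembly_proof hP h₁ (etaTransportSigned_of_thm74 h74) h₃ h₄ W p hr hp5 hadd hGss

/-- **The by-rank bill of the Gss2 assembly, both ranks in one statement**: on a Gss2 pair `(W, p)`,
`p ≥ 5`, `r_an(W) ≤ 1`, `MissingPPartAt W p` follows from the published inputs, (C1_η) and (R2⁺), AND —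
only in case `r_an(W) = 1` — from `PublishedInputThm74` (Kobayashi Thm. 7.4 at `η`), (R2⁻) and the
residual `PAdicGrossZagierBranch`, the three of them displayed as ONE implication guarded by
`W.analyticRank = 1`. CONDITIONAL; nothing booked.
[cite: Kobayashi2003, §4 (p. 8), Thm. 7.4 (p. 13), Thm. 9.3 (p. 26)] [cite: Mazur1978, Cor. 4.1]
[cite: KitajimaOtsuki2018, Main Thm. 1.3] [cite: GrossZagier1986, Thm. I.(7.3) (p. 230)] -/
theorem missingPPartAt_gss2_byRank (hP : PublishedInputsGss2) (h₁ : PlusMainConjectureBranch)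
    (h₃ : NoFiniteSubmodulePlus)
    (W : WeierstrassCurve ℚ) [W.IsElliptic] [W.IsGloballyMinimal] (p : ℕ) [Fact p.Prime]
    (hrank1 : W.analyticRank = 1 →
      PublishedInputThm74 ∧ OddBranchStrictMinusNoFiniteSubmoduleAt W p ∧
        QuadraticBranchPAdicGrossZagierValuationAt W p)
    (hr : W.analyticRank ≤ 1) (hp5 : 5 ≤ p) (hadd : Addv W p) (hGss : SubGss W p) :
    MissingPPartAt W p := by
  obtain ⟨hGZK, hmod, hnf, hGZ, hPT, hM⟩ := hP
  rcases Nat.le_one_iff_eq_zero_or_eq_one.mp hr with h0 | h1r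
  · exact missingPPartAt_gss2_rankZero_of_plusMC_of_noFiniteSubmodulePlus_of_mazur hGZK hmod hnf hPT
      hM h₁ h₃ W p h0 hp5 hadd hGss
  · obtain ⟨h74, hR2m, hGZp⟩ := hrank1 h1r
    have hp2 : p ≠ 2 := by omega
    obtain ⟨V, hVe, hVm, C, hCV, hss⟩ :=
      Summit.BirchSwinnertonDyer.Rank1Residual.O5.exists_goodSS_twist_pStar_of_subGss W p hp2 hadd hGss
    have hgood : V.HasGoodReductionAtPrime p := hss.1
    have hap : V.frobeniusTrace p = 0 :=
      (V.natCast_dvd_frobeniusTrace_iff_eq_zero p hp5 hgood).mp hss.2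
    have h1 : QuadraticBranchPlusMainConjectureAt V p := h₁ V p hp5 hgood hap
    have h₂ : EtaTransportSigned := etaTransportSigned_of_thm74 h74
    haveI : Finite W.sha := (hGZK W hr).2
    exact missingPPartAt_of_bsdp W p
      (LevelBridge.bsdp_of_plusMC_of_pAdicGrossZagierValuation_of_readings_of_periodRatio W p hmod hGZ
        hGZK hPT hnf (periodRatio_of_mazur p hM hp5) hR2m
        (LevelBridge.exactOddBranchReading_of_kobayashi74OddEtaExact W p (h₂.2 p hp5))
        hGZp hp5 hCV hgood hap h1 h1r)

end Summit.BirchSwinnertonDyer.BirchSwinnertonDyer.Theorems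

end
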